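import Mathlib.LinearAlgebra.Span.Basic
import Mathlib.Algebra.Module.Submodule.Map
import Mathlib.Algebra.Module.Submodule.Ker
import Mathlib.Algebra.Module.Submodule.Range
import Mathlib.LinearAlgebra.Prod
import Mathlib.LinearAlgebra.Quotient.Basic
import Mathlib.RingTheory.Ideal.Basic
import Mathlib.RingTheory.Nakayama
import Mathlib.Order.ModularLattice
import Mathlib.Tactic.Abel
import Mathlib.Tactic.Module
import Mathlib.Tactic.NoncommRing
import Summits.BirchSwinnertonDyer.Rank1Residual.X4.NilpotentPartIsBottomLattice
import HarnessLib

/-!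
# The `U_p`-nilpotent part at the semistable level `pM` is the bottom lattice — Proposition V64-B (B2) assembled in the kernel, with REFEREE 2's three checkpoints (R2-155.3) as displayed hypotheses (cell `b2b-bsdres`, seat additive-p4 gen 38, line V64/V66)

HONEST FRAMING (verbatim, cell `b2b-bsdres`): the goal of the cell is to DELETE the COMBINATION-SHAPED
residual classes for ALL analytic-rank `≤ 1` curves over `ℚ` — "full BSD formula for every rank `≤ 1`
curve in class `C`" assembled STRICTLY from published theorems — so that the rank-`≤ 1` remainder
becomes exactly the CONSTRUCTION-SHAPED classes, which are TYPED (missing-input Props), NOT attempted;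
this is not "finishing BSD". This file: TOOL theorems (pure module algebra; 0 defs, 0 facts, nothing
booked; X4 stays CONSTRUCTION-SHAPED; no mark moves).

## What is proved, and which hypothesis is which checkpoint

Setting of memo V64 §3: `R = 𝕋(M)_𝔪` (commutative), `K = H_{M,𝔪}` (the `p`-minimal block),
`Y = H_{pM,𝔪}`, the two `p`-degeneracy maps `d₁ dₚ : K →ₗ[R] Y`, `j′ = d₁.coprod dₚ`, `U = U_p` on
`Y`, `t = T_p ∈ R`, Hensel's roots `u₀ ∈ 𝔪`, `u₁ ∈ R^×` of `U² − tU + p` with `u₁ − u₀` a unit, and the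
idempotent `e` of the `U_p`-topologically-nilpotent part (`N = Fix e`). REFEREE 2 (R2-155.3) asked
for three things to be DISPLAYED rather than folklore; they are the named binders below.

* (ii) THE CONVENTION, PINNED: `hU₁ : U (d₁ x) = d₁ (t • x) − p • dₚ x`, `hUₚ : U (dₚ x) = d₁ x`
  (q-expansions: `U_p f = T_p f − p·f|B_p`, `U_p (f|B_p) = f`). `pOldPair_coprod_apply`: this IS
  K111's pair operator `𝒰(x, y) = (t•x + y, −p•x)`, i.e. `U ∘ j′ = j′ ∘ 𝒰`. `U_intertwiner_apply`:
  the displayed map `φ₀ = d₁ + (u₀ − t) • dₚ` satisfies `U ∘ φ₀ = u₀ • φ₀` — VERIFIED against this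
  convention (the TRANSPOSE convention and its intertwiner `u₀ • d₁ + dₚ` are in the companion file
  `UpNilpotentPartLatticeClause`: the structural conclusion is convention-independent).
* (i) "NILPOTENT PART ⊆ `p`-OLD PART" needs `U_p` INVERTIBLE on the `p`-new quotient: displayed as
  `hAL : U (U y) − y ∈ range j′` (`U_p² = 1` on `Y / j′(K × K)`: on `p`-new forms `U_p = ∓ W_p`),
  together with ONE step of topological nilpotence `hnil : Uⁿ (e y) ∈ I•⊤ ⊔ range j′` for an ideal
  `I ≤ Jac R` (`I = 𝔪`) and `Module.Finite R Y`; `range_le_of_sq_eq_one_on_quotient` then gives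
  `e(Y) ≤ range j′` by NAKAYAMA applied to the induced idempotent of the quotient
  (`range_eq_bot_of_idempotent_of_le_smul`).
* Ihara at `p ∤ M` enters BY NAME as `hj : Function.Injective j′` (Ribet 1984 Thm 4.1; the
  application supplies it); Hensel's bookkeeping as `he₀ : e = 1 on φ₀(K)`, `he₁ : e = 0 on φ₁(K)`.
* HEADLINE `upNilpotentPart_eq_range_intertwiner`: under these, `N = range φ₀` (so `φ₀ : K ≅ N`),
  `U = u₀` on `N`, and two-prime saturation (T-V54) of any `S ≤ K` transfers to `S.map φ₀ ≤ N` and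
  back. Ingredients: `eigen_iff_mem_range_intertwiner` (`ker(U − u₀) ∩ old = range φ₀`, from K111's
  `mem_ker_pOldPairOp_sub_iff` + `hj`), `range_coprod_eq_sup_range_intertwiner` and
  `range_intertwiner_inf_eq_bot` (old part `= range φ₀ ⊕ range φ₁` when `u₁ − u₀` is a unit),
  `fixedSubmodule_eq_range_intertwiner` (modular law).
* (iii) THE LATTICE CLAUSE `O_{ℓ_i}(Y) ∩ N = φ₀(O_{ℓ_i}(K))` and case (B1) are in the companion file
  `UpNilpotentPartLatticeClause` (a diagram chase with the idempotent one level down; no saturation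
  input — saturation (Ihara) is used exactly once, in `hj` here).

Not formalised (the APPLICATION's inputs, displayed in memo V64 §3 / V66 §2): the q-expansion
identities themselves, Hensel's lemma in `𝕋(M)_𝔪`, `U_p = ∓W_p` on `p`-new forms, Ihara.

## References (context only; the proofs are elementary)

* A. Wiles, Ann. of Math. 141 (1995), §2 (the `p`-old pair and `U_p`). [cite: Wiles1995, §2]
* K. Ribet, Proc. ICM 1983 (1984), Thm. 4.1 (Ihara's lemma, BY NAME). [cite: Ribet1984ICM, Thm. 4.1]
-/

namespace Summit.BirchSwinnertonDyer.Rank1Residual.LevelLowering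

section ConventionPinned

variable {R K Y : Type*} [CommRing R] [AddCommGroup K] [Module R K] [AddCommGroup Y] [Module R Y]

/-- **Convention (A), pinned (REFEREE 2 R2-155.3 (ii)).** With `U (d₁ x) = d₁ (t•x) − p • dₚ x` and
`U (dₚ x) = d₁ x` (q-expansions `U_p f = T_p f − p·f|B_p`, `U_p(f|B_p) = f`), `U_p` acts on the
`p`-old pair through K111's operator `𝒰(x, y) = (t•x + y, −(p•x))`: `U ∘ j′ = j′ ∘ 𝒰`, `j′ = d₁.coprod dₚ`.
[cite: Wiles1995, §2] -/
theorem pOldPair_coprod_apply (t p : R) (d₁ dₚ : K →ₗ[R] Y) (U : Y →ₗ[R] Y)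
    (hU₁ : ∀ x, U (d₁ x) = d₁ (t • x) - p • dₚ x) (hUₚ : ∀ x, U (dₚ x) = d₁ x) (w : K × K) :
    U (d₁.coprod dₚ w) = d₁.coprod dₚ (t • w.1 + w.2, -(p • w.1)) := by
  obtain ⟨x, y⟩ := w
  simp only [LinearMap.coprod_apply, map_add, hU₁, hUₚ, map_neg, map_smul]
  abel

/-- The displayed intertwiner `d₁ + c • dₚ` is `j′` composed with K111's graph map `x ↦ (x, c • x)`. -/
theorem intertwiner_eq_coprod_comp_graphMap (c : R) (d₁ dₚ : K →ₗ[R] Y) :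
    d₁ + c • dₚ = (d₁.coprod dₚ) ∘ₗ (LinearMap.id.prod (c • LinearMap.id) : K →ₗ[R] K × K) := by
  ext x
  simp

/-- **The intertwiner, VERIFIED against convention (A)** (R2-155.3 (ii)): for a root `u₀` of
`U² − tU + p` (`u₀·u₀ = t·u₀ − p`), `φ₀ := d₁ + (u₀ − t) • dₚ` satisfies `U (φ₀ x) = u₀ • φ₀ x`
(memo V64 §3 (B2): `φ(x) = d₁^* x + d_p^*((u₀ − T_p) x)`). [cite: Wiles1995, §2] -/
theorem U_intertwiner_apply (t p u₀ : R) (hu : u₀ * u₀ = t * u₀ - p)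
    (d₁ dₚ : K →ₗ[R] Y) (U : Y →ₗ[R] Y)
    (hU₁ : ∀ x, U (d₁ x) = d₁ (t • x) - p • dₚ x) (hUₚ : ∀ x, U (dₚ x) = d₁ x) (x : K) :
    U ((d₁ + (u₀ - t) • dₚ) x) = u₀ • (d₁ + (u₀ - t) • dₚ) x := by
  have hp : p = t * u₀ - u₀ * u₀ := by rw [hu]; ring
  subst hp
  simp only [LinearMap.add_apply, LinearMap.smul_apply, map_add, map_smul, hU₁, hUₚ]
  module

/-- **`ker(U − u₀) ∩ (p-old part) = range φ₀`.** Under convention (A), a root `u₀`, and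
INJECTIVITY of `j′ = d₁.coprod dₚ` (Ihara at `p ∤ M`, BY NAME in the application): an element `w` of
the `p`-old part is a `u₀`-eigenvector of `U` iff it lies in the range of `φ₀ = d₁ + (u₀ − t) • dₚ`
(K111's `mem_ker_pOldPairOp_sub_iff` transported along `j′`). [cite: Ribet1984ICM, Thm. 4.1] -/
theorem eigen_iff_mem_range_intertwiner (t p u₀ : R) (hu : u₀ * u₀ = t * u₀ - p)
    (d₁ dₚ : K →ₗ[R] Y) (U : Y →ₗ[R] Y)
    (hU₁ : ∀ x, U (d₁ x) = d₁ (t • x) - p • dₚ x) (hUₚ : ∀ x, U (dₚ x) = d₁ x)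
    (hj : Function.Injective (d₁.coprod dₚ))
    (w : Y) (hw : w ∈ LinearMap.range (d₁.coprod dₚ)) :
    U w = u₀ • w ↔ w ∈ LinearMap.range (d₁ + (u₀ - t) • dₚ) := by
  obtain ⟨v, rfl⟩ := LinearMap.mem_range.mp hw
  rw [pOldPair_coprod_apply t p d₁ dₚ U hU₁ hUₚ v, ← map_smul,
    intertwiner_eq_coprod_comp_graphMap (u₀ - t) d₁ dₚ, LinearMap.range_comp]
  constructor
  · intro h
    have hv : (t • v.1 + v.2, -(p • v.1)) = u₀ • v := hj h
    have h2 : v.2 = (u₀ - t) • v.1 := by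
      rw [← mem_ker_pOldPairOp_sub_iff t p u₀ hu v]
      exact ⟨congrArg Prod.fst hv, by simpa using congrArg Prod.snd hv⟩
    exact Submodule.mem_map_of_mem ((mem_range_graphMap_iff (u₀ - t) v).mpr h2)
  · intro h
    obtain ⟨v', hv', hvv'⟩ := Submodule.mem_map.mp h
    have : v' = v := hj hvv'
    subst this
    have h2 : v'.2 = (u₀ - t) • v'.1 := (mem_range_graphMap_iff (u₀ - t) v').mp hv'
    obtain ⟨h1, h3⟩ := (mem_ker_pOldPairOp_sub_iff t p u₀ hu v').mpr h2
    congr 1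
    ext <;> simp [h1, h3]

/-- The two eigenlattices are disjoint: `range φ₀ ⊓ range φ₁ = ⊥` when `u₁ − u₀` is a unit and `j′`
is injective (`φᵢ = d₁ + (uᵢ − t) • dₚ`). -/
theorem range_intertwiner_inf_eq_bot (t u₀ u₁ : R) (hunit : IsUnit (u₁ - u₀))
    (d₁ dₚ : K →ₗ[R] Y) (hj : Function.Injective (d₁.coprod dₚ)) :
    LinearMap.range (d₁ + (u₀ - t) • dₚ) ⊓ LinearMap.range (d₁ + (u₁ - t) • dₚ) = ⊥ := by
  rw [eq_bot_iff]
  intro w ⟨h₀, h₁⟩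
  rw [SetLike.mem_coe, intertwiner_eq_coprod_comp_graphMap, LinearMap.range_comp] at h₀ h₁
  obtain ⟨v₀, hv₀, rfl⟩ := Submodule.mem_map.mp h₀
  obtain ⟨v₁, hv₁, he⟩ := Submodule.mem_map.mp h₁
  have hvv : v₁ = v₀ := hj he
  subst hvv
  rw [mem_range_graphMap_iff] at hv₀ hv₁
  have hx : (u₁ - u₀) • v₁.1 = 0 := by
    have := hv₁.symm.trans hv₀
    -- (u₁ - t) • v.1 = (u₀ - t) • v.1
    have h' : (u₁ - t) • v₁.1 - (u₀ - t) • v₁.1 = 0 := sub_eq_zero.mpr this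
    rw [← sub_smul] at h'
    simpa [sub_sub_sub_cancel_right] using h'
  obtain ⟨u, hu⟩ := hunit
  have hx0 : v₁.1 = 0 := by
    have := congrArg (fun z => u.inv • z) hx
    simp only [smul_smul, smul_zero] at this
    rwa [← hu, Units.inv_eq_val_inv, Units.inv_mul, one_smul] at this
  have hv0 : v₁ = 0 := by
    ext
    · exact hx0
    · rw [hv₀, hx0, smul_zero]; rfl
  rw [Submodule.mem_bot, hv0, map_zero]

/-- **The `p`-old part decomposes**: `range j′ = range φ₀ ⊔ range φ₁` when `u₁ − u₀` is a unit
(Hensel: simple roots mod `𝔪`; explicitly `(x, y) = (x − x₁, (u₀−t)(x − x₁)) + (x₁, (u₁−t)x₁)` with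
`x₁ = (u₁ − u₀)⁻¹ (y − (u₀ − t) x)`). No use of the quadratic relation. -/
theorem range_coprod_eq_sup_range_intertwiner (t u₀ u₁ : R) (hunit : IsUnit (u₁ - u₀))
    (d₁ dₚ : K →ₗ[R] Y) :
    LinearMap.range (d₁.coprod dₚ)
      = LinearMap.range (d₁ + (u₀ - t) • dₚ) ⊔ LinearMap.range (d₁ + (u₁ - t) • dₚ) := by
  apply le_antisymm
  · rintro w ⟨v, rfl⟩
    obtain ⟨u, hu⟩ := hunit
    -- decomposition: v = (x, y); x₁ := u⁻¹ • (y - (u₀ - t) • x), x₀ := x - x₁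
    set x₁ : K := u.inv • (v.2 - (u₀ - t) • v.1) with hx₁
    set x₀ : K := v.1 - x₁ with hx₀
    have hsum : (d₁ + (u₀ - t) • dₚ) x₀ + (d₁ + (u₁ - t) • dₚ) x₁ = d₁.coprod dₚ v := by
      have key : (u₁ - u₀) • x₁ = v.2 - (u₀ - t) • v.1 := by
        rw [hx₁, smul_smul, ← hu, Units.inv_eq_val_inv, Units.mul_inv, one_smul]
      have key' : (u₁ - u₀) • dₚ x₁ = dₚ v.2 - (u₀ - t) • dₚ v.1 := by
        rw [← map_smul, key, map_sub, map_smul]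
      simp only [LinearMap.add_apply, LinearMap.smul_apply, LinearMap.coprod_apply, hx₀, map_sub]
      linear_combination (norm := module) key'
    rw [← hsum]
    exact Submodule.add_mem_sup (LinearMap.mem_range_self _ x₀) (LinearMap.mem_range_self _ x₁)
  · rw [intertwiner_eq_coprod_comp_graphMap (u₀ - t), intertwiner_eq_coprod_comp_graphMap (u₁ - t),
      LinearMap.range_comp, LinearMap.range_comp]
    exact sup_le LinearMap.map_le_range LinearMap.map_le_range

/-- **`N = range φ₀`** for the fixed submodule `N` of an endomorphism `e` (Hensel's idempotent of the
`U_p`-nilpotent part) which is `1` on `φ₀(K)` (`u₀ ∈ 𝔪`), `0` on `φ₁(K)` (`u₁` a unit), and whose fixed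
points lie in the `p`-old part (`hNold` — checkpoint (i), discharged by
`range_le_of_sq_eq_one_on_quotient` below): modular law in the lattice of submodules. -/
theorem fixedSubmodule_eq_range_intertwiner (t u₀ u₁ : R) (hunit : IsUnit (u₁ - u₀))
    (d₁ dₚ : K →ₗ[R] Y) (e : Y →ₗ[R] Y) (N : Submodule R Y) (hN : ∀ y, y ∈ N ↔ e y = y)
    (hNold : N ≤ LinearMap.range (d₁.coprod dₚ))
    (he₀ : ∀ x, e ((d₁ + (u₀ - t) • dₚ) x) = (d₁ + (u₀ - t) • dₚ) x)
    (he₁ : ∀ x, e ((d₁ + (u₁ - t) • dₚ) x) = 0) :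
    N = LinearMap.range (d₁ + (u₀ - t) • dₚ) := by
  have h₀ : LinearMap.range (d₁ + (u₀ - t) • dₚ) ≤ N := by
    rintro w ⟨x, rfl⟩
    exact (hN _).mpr (he₀ x)
  have h₁ : N ⊓ LinearMap.range (d₁ + (u₁ - t) • dₚ) = ⊥ := by
    rw [eq_bot_iff]
    rintro w ⟨hw, ⟨x, rfl⟩⟩
    rw [Submodule.mem_bot, ← (hN _).mp hw, he₁ x]
  calc N = N ⊓ LinearMap.range (d₁.coprod dₚ) := (inf_eq_left.mpr hNold).symm
    _ = N ⊓ (LinearMap.range (d₁ + (u₀ - t) • dₚ) ⊔ LinearMap.range (d₁ + (u₁ - t) • dₚ)) := by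
        rw [range_coprod_eq_sup_range_intertwiner t u₀ u₁ hunit]
    _ = LinearMap.range (d₁ + (u₀ - t) • dₚ) ⊔ N ⊓ LinearMap.range (d₁ + (u₁ - t) • dₚ) := by
        rw [inf_comm, sup_inf_assoc_of_le _ h₀, inf_comm]
    _ = LinearMap.range (d₁ + (u₀ - t) • dₚ) := by rw [h₁, sup_bot_eq]

end ConventionPinned

section Transfer

variable {R K Y : Type*} [CommRing R] [AddCommGroup K] [Module R K] [AddCommGroup Y] [Module R Y]

/-- **T-V54 transfers along an injective map**: `S` is `r`-saturated in `K` iff `φ(S)` is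
`r`-saturated in `range φ` (generalises K111's `smul_mem_sup_map_graph_iff`). -/
theorem smul_mem_imp_iff_map_of_injective (φ : K →ₗ[R] Y) (hφ : Function.Injective φ) (r : R)
    (S : Submodule R K) :
    (∀ x : K, r • x ∈ S → x ∈ S) ↔
    (∀ w ∈ LinearMap.range φ, r • w ∈ S.map φ → w ∈ S.map φ) := by
  constructor
  · rintro hsat w ⟨x, rfl⟩ hrw
    obtain ⟨y, hy, hyx⟩ := Submodule.mem_map.mp hrw
    have : y = r • x := hφ (by rw [hyx, map_smul])
    rw [this] at hy
    exact Submodule.mem_map_of_mem (hsat x hy)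
  · intro hsat x hx
    have h1 : r • φ x ∈ S.map φ := by
      rw [← map_smul]; exact Submodule.mem_map_of_mem hx
    obtain ⟨y, hy, hyx⟩ := Submodule.mem_map.mp (hsat (φ x) (LinearMap.mem_range_self φ x) h1)
    rwa [← hφ hyx]

end Transfer

section CheckpointOne

variable {R Y : Type*} [CommRing R] [AddCommGroup Y] [Module R Y]

/-- **Nakayama for an idempotent**: an idempotent endomorphism of finitely generated range whose range
lies in `I • ⊤` for an ideal `I ≤ Jac(R)` is zero. -/
theorem range_eq_bot_of_idempotent_of_le_smul (e : Y →ₗ[R] Y) (he : ∀ y, e (e y) = e y)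
    (I : Ideal R) (hI : I ≤ Ideal.jacobson ⊥) (hfg : (LinearMap.range e).FG)
    (hsmall : LinearMap.range e ≤ I • ⊤) : LinearMap.range e = ⊥ := by
  refine Submodule.eq_bot_of_le_smul_of_le_jacobson_bot I (LinearMap.range e) hfg ?_ hI
  rintro w ⟨y, rfl⟩
  have h1 : e y ∈ I • (⊤ : Submodule R Y) := hsmall (LinearMap.mem_range_self e y)
  have h2 : e (e y) ∈ (I • (⊤ : Submodule R Y)).map e := Submodule.mem_map_of_mem h1
  rw [he, Submodule.map_smul'', Submodule.map_top] at h2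
  exact h2

/-- **Checkpoint (i) (REFEREE 2 R2-155.3): the `U_p`-nilpotent idempotent kills the `p`-new quotient.**
`P ≤ Y` (`= j′(K × K)`) is `U`- and `e`-stable, `e` is an idempotent commuting with `U`,
`hAL : U (U y) − y ∈ P` — **`U_p² = 1` on the `p`-new quotient `Y/P`** (on `p`-new forms
`U_p = ∓ W_p` is an involution, a UNIT at every maximal ideal) —, and ONE step of topological
nilpotence `hnil : Uⁿ(e y) ∈ I • ⊤ ⊔ P` for an ideal `I ≤ Jac(R)` (`I = 𝔪𝕋(M)_𝔪`); then
`e(Y) ≤ P`. Proof: on `Y/P`, `ē = Ū²ⁿ ē ≡ 0 (mod I)`, and Nakayama. [cite: Wiles1995, §2] -/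
theorem range_le_of_sq_eq_one_on_quotient [Module.Finite R Y] (P : Submodule R Y) (U e : Y →ₗ[R] Y)
    (he : ∀ y, e (e y) = e y) (heU : ∀ y, e (U y) = U (e y))
    (hUP : ∀ y ∈ P, U y ∈ P) (heP : ∀ y ∈ P, e y ∈ P)
    (hAL : ∀ y, U (U y) - y ∈ P)
    (I : Ideal R) (hI : I ≤ Ideal.jacobson ⊥)
    (n : ℕ) (hnil : ∀ y, (U ^ n) (e y) ∈ I • (⊤ : Submodule R Y) ⊔ P) :
    LinearMap.range e ≤ P := by
  -- powers of U commute with e, and preserve P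
  have hcommY : ∀ m z, e ((U ^ m) z) = (U ^ m) (e z) := by
    intro m; induction m with
    | zero => intro z; simp
    | succ m ih => intro z; rw [pow_succ, Module.End.mul_apply, Module.End.mul_apply, ih, heU]
  have hUpowP : ∀ m, ∀ y ∈ P, (U ^ m) y ∈ P := by
    intro m; induction m with
    | zero => intro y hy; simpa using hy
    | succ m ih => intro y hy; rw [pow_succ, Module.End.mul_apply]; exact ih _ (hUP y hy)
  -- U^(2m) ≡ 1 modulo P
  have hsq : ∀ m y, (U ^ (2 * m)) y - y ∈ P := by
    intro m; induction m with
    | zero => intro y; simp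
    | succ m ih =>
      intro y
      have e1 : (U ^ (2 * (m + 1))) y - y
          = ((U ^ (2 * m)) (U (U y)) - U (U y)) + (U (U y) - y) := by
        rw [Nat.mul_succ, pow_add, Module.End.mul_apply, pow_two, Module.End.mul_apply]; abel
      rw [e1]
      exact P.add_mem (ih _) (hAL y)
  -- the induced idempotent on the quotient is small, hence zero by Nakayama
  set eb : Y ⧸ P →ₗ[R] Y ⧸ P := P.mapQ P e (fun y hy => heP y hy) with heb
  have heb_idem : ∀ q, eb (eb q) = eb q := by
    intro q
    induction q using Submodule.Quotient.induction_on with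
    | _ y => simp only [heb, Submodule.mapQ_apply, he]
  have hsmall : LinearMap.range eb ≤ I • ⊤ := by
    rintro w ⟨q, rfl⟩
    induction q using Submodule.Quotient.induction_on with
    | _ y =>
      rw [heb, Submodule.mapQ_apply]
      -- e y = e (e y) ≡ U^(2n) (e (e y)) = U^n (e (U^n (e y)))  (mod P)
      have h3 : (U ^ n) (e ((U ^ n) (e y))) ∈ I • (⊤ : Submodule R Y) ⊔ P := hnil _
      have h4 : (U ^ n) (e ((U ^ n) (e y))) = (U ^ (2 * n)) (e y) := by
        rw [hcommY n, he, ← Module.End.mul_apply, ← pow_add, ← two_mul]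
      have h5 : e y - (U ^ (2 * n)) (e y) ∈ P := by
        have := P.neg_mem (hsq n (e y)); simpa using this
      have h6 : e y ∈ I • (⊤ : Submodule R Y) ⊔ P := by
        have : e y = (U ^ (2 * n)) (e y) + (e y - (U ^ (2 * n)) (e y)) := by abel
        rw [this]
        exact Submodule.add_mem _ (h4 ▸ h3) (Submodule.mem_sup_right h5)
      have h7 : Submodule.Quotient.mk (e y) ∈ (I • (⊤ : Submodule R Y) ⊔ P).map P.mkQ :=
        Submodule.mem_map_of_mem h6
      rw [Submodule.map_sup, Submodule.map_smul'', Submodule.map_top, Submodule.range_mkQ,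
        Submodule.mkQ_map_self, sup_bot_eq] at h7
      exact h7
  have hfg' : (LinearMap.range eb).FG := by
    rw [LinearMap.range_eq_map]; exact (Module.Finite.fg_top).map _
  have hbot := range_eq_bot_of_idempotent_of_le_smul eb heb_idem I hI hfg' hsmall
  rintro w ⟨y, rfl⟩
  have hm : eb (Submodule.Quotient.mk y) ∈ LinearMap.range eb := LinearMap.mem_range_self _ _
  rw [hbot, Submodule.mem_bot, heb, Submodule.mapQ_apply, Submodule.Quotient.mk_eq_zero] at hm
  exact hm

end CheckpointOne

section Headline

variable {R K Y : Type*} [CommRing R] [AddCommGroup K] [Module R K] [AddCommGroup Y] [Module R Y]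

/-- **PROPOSITION V64-B (B2), kernel form — the `U_p`-nilpotent part of the semistable level IS the
bottom lattice.** DATA/HYPOTHESES (each a displayed input of memo V64 §3, REFEREE 2 R2-155.3):
convention (A) `hU₁`/`hUₚ` [(ii), pinned]; a root `u₀` and a second scalar `u₁` with `u₁ − u₀` a unit
[Hensel]; `hj` = injectivity of `j′ = d₁.coprod dₚ` [Ihara at `p ∤ M`, BY NAME]; an idempotent `e`
commuting with `U`, equal to `1` on `φ₀(K)` and `0` on `φ₁(K)` [Hensel's idempotent of the
`U_p`-nilpotent part; `u₀ ∈ 𝔪`, `u₁ ∈ R^×`]; `hAL` = `U² = 1` on `Y / j′(K × K)` [(i): `U_p = ∓W_p` on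
`p`-new forms] with one step of nilpotence `hnil` modulo an ideal `I ≤ Jac(R)`, `Y` finite over `R`.
CONCLUSION for `N = Fix(e)` (the nilpotent part): `N = range φ₀` (`φ₀ = d₁ + (u₀ − t) • dₚ`, injective),
`U = u₀` on `N`, and for every `S ≤ K` (e.g. `S = O_{ℓ₁}(K) ⊔ O_{ℓ₂}(K)`): `S` is `r`-saturated in `K`
iff `φ₀(S)` is `r`-saturated in `N` — T-V54 at `(pM, 𝔪, U_p-nilpotent)` ⟺ T-V54 at `(M, 𝔪)` once
the lattice clause `oldLattice_inf_nilpotentPart_eq` identifies `O_{ℓ_i}(Y) ∩ N` with `φ₀(O_{ℓ_i}(K))`.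
Research-route tool theorem; nothing booked. [cite: Wiles1995, §2] -/
theorem upNilpotentPart_eq_range_intertwiner [Module.Finite R Y]
    (t p u₀ u₁ : R) (hu₀ : u₀ * u₀ = t * u₀ - p) (hunit : IsUnit (u₁ - u₀))
    (d₁ dₚ : K →ₗ[R] Y) (U e : Y →ₗ[R] Y)
    (hU₁ : ∀ x, U (d₁ x) = d₁ (t • x) - p • dₚ x) (hUₚ : ∀ x, U (dₚ x) = d₁ x)
    (hj : Function.Injective (d₁.coprod dₚ))
    (he : ∀ y, e (e y) = e y) (heU : ∀ y, e (U y) = U (e y))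
    (he₀ : ∀ x, e ((d₁ + (u₀ - t) • dₚ) x) = (d₁ + (u₀ - t) • dₚ) x)
    (he₁ : ∀ x, e ((d₁ + (u₁ - t) • dₚ) x) = 0)
    (hAL : ∀ y, U (U y) - y ∈ LinearMap.range (d₁.coprod dₚ))
    (I : Ideal R) (hI : I ≤ Ideal.jacobson ⊥) (n : ℕ)
    (hnil : ∀ y, (U ^ n) (e y) ∈ I • (⊤ : Submodule R Y) ⊔ LinearMap.range (d₁.coprod dₚ))
    (N : Submodule R Y) (hN : ∀ y, y ∈ N ↔ e y = y) :
    N = LinearMap.range (d₁ + (u₀ - t) • dₚ)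
    ∧ Function.Injective (d₁ + (u₀ - t) • dₚ)
    ∧ (∀ w ∈ N, U w = u₀ • w)
    ∧ ∀ (r : R) (S : Submodule R K), ((∀ x : K, r • x ∈ S → x ∈ S) ↔
        (∀ w ∈ N, r • w ∈ S.map (d₁ + (u₀ - t) • dₚ) → w ∈ S.map (d₁ + (u₀ - t) • dₚ))) := by
  set P : Submodule R Y := LinearMap.range (d₁.coprod dₚ) with hP
  -- U and e preserve the p-old part
  have hUP : ∀ y ∈ P, U y ∈ P := by
    rintro y ⟨w, rfl⟩
    rw [pOldPair_coprod_apply t p d₁ dₚ U hU₁ hUₚ w]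
    exact LinearMap.mem_range_self _ _
  have hdec := range_coprod_eq_sup_range_intertwiner t u₀ u₁ hunit d₁ dₚ
  have heP : ∀ y ∈ P, e y ∈ P := by
    intro y hy
    rw [hP, hdec] at hy
    obtain ⟨a, ha, b, hb, rfl⟩ := Submodule.mem_sup.mp hy
    obtain ⟨xa, rfl⟩ := LinearMap.mem_range.mp ha
    obtain ⟨xb, rfl⟩ := LinearMap.mem_range.mp hb
    rw [map_add, he₀, he₁, add_zero, hP, hdec]
    exact Submodule.mem_sup_left (LinearMap.mem_range_self _ _)
  -- checkpoint (i): Fix(e) ≤ e(Y) ≤ P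
  have hrange : LinearMap.range e ≤ P :=
    range_le_of_sq_eq_one_on_quotient P U e he heU hUP heP hAL I hI n hnil
  have hNold : N ≤ P := by
    intro y hy
    rw [← (hN y).mp hy]
    exact hrange (LinearMap.mem_range_self e y)
  have hNeq : N = LinearMap.range (d₁ + (u₀ - t) • dₚ) :=
    fixedSubmodule_eq_range_intertwiner t u₀ u₁ hunit d₁ dₚ e N hN hNold he₀ he₁
  have hinj : Function.Injective (d₁ + (u₀ - t) • dₚ) := by
    rw [intertwiner_eq_coprod_comp_graphMap]
    exact hj.comp (graphMap_injective (u₀ - t))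
  refine ⟨hNeq, hinj, ?_, ?_⟩
  · intro w hw
    have hw' : w ∈ LinearMap.range (d₁ + (u₀ - t) • dₚ) := hNeq ▸ hw
    exact (eigen_iff_mem_range_intertwiner t p u₀ hu₀ d₁ dₚ U hU₁ hUₚ hj w (hNold hw)).mpr hw'
  · intro r S
    rw [hNeq]
    exact smul_mem_imp_iff_map_of_injective _ hinj r S

end Headline

end Summit.BirchSwinnertonDyer.Rank1Residual.LevelLowering
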